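import Literature.MathematicalPhysics.QuantumLattice.HubbardTPPWeightedClusterFloorInfVol
import Literature.MathematicalPhysics.QuantumLattice.HubbardTTPrimeTPPDoublingUAnchors
import Literature.MathematicalPhysics.QuantumLattice.HubbardTTPrimeCapCutDualRows
import HarnessLib

/-!
# The weighted cluster floor for object M with a SPLIT third-neighbour amplitude: part of `t''` exactly in the
# cluster, the remainder by the dressed (doubling) allowance

Topic `MathematicalPhysics/QuantumLattice`, family `hubbard` (seat hubbard-box-p3, S2, hypothesis-free tier).
Companion of `HubbardTPPWeightedClusterFloorInfVol` (`tiGroundEnergyDensityAt_tpp_ge_of_boxFloorsW_2x3`: the WHOLE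
`t''` read by the weighted `2 × 3` cluster, axial weight `t''/2`) and of `HubbardTTPrimeTPPDoublingUAnchors` (the
`U`-dressed third-neighbour allowance: `|s'|·e(1,0,V,ρ) ≤ s'·K₃(σ) + |s'|V·D(σ)` for every translation-invariant `σ`,
`IsTranslationInvariant.abs_mul_energyDensityTT'_nn_le_tpp_add`). Each third-neighbour bond of `ℤ²` has only two
covering placements among the translates of the `2 × 3` box and its transpose, so the exact cluster carries `t''` at
the RELATIVE strength `(t''/2)/(t/7) = 3.5·t''/t` and the floor falls steeply in `t''` (numerically ≈ `1.16·|t''|` per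
site at uniform weights, against the free allowance `16/π² ≈ 1.62`); splitting `t'' = 2a + (t'' − 2a)` — an axial
weight `a` in the cluster, the remainder `t'' − 2a` priced by the dressed allowance with a repulsion budget
`|t'' − 2a|·V` taken out of the cluster's `U` — is again an exact decomposition of the lattice Hamiltonian, and the
best `a` is interior when `|t''| ≳ 0.2 t` (numerics: HOME tables/WEIGHTED-T3-2x3-weights-g17.md §hybrid).

**THE LAW** (`tiGroundEnergyDensityAt_tpp_ge_of_boxFloorsW_2x3_split`): `τ` symmetric, `wsumV τ + wsumH τ = t`,
`2·wsumD₁ τ = 2·wsumD₂ τ = t'`, `V ≥ 0`, `2·Σ υ + |s − 2a|·V = U`, `Σ ν = 0`, one kernel table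
`σ_k ≤ E₀(hubbardOpenBoxTT'T''W 2 3 τ υ ν a, k)` (`k ≤ 12`), a supporting line `m ≤ σ_k + μk`, and a certified
`t' = 0` row `ℓ ≤ e(1, 0, V, ρ)` (at `V = 0`: any certified constant below the free band energy, e.g. `−16/π²`)
give `2m − 12μρ + |s − 2a|·ℓ ≤ e^M(t,t',s,U; ρ)`. At `a = s/2` this is the exact law; at `a = 0` it is the
`t''`-kinematic word of a weighted `t–t'` table (the weighted twin of `le_tpp_of_floor_add_abs_mul`). Everything is
proved; no definition, no named fact.

References: P. W. Anderson, Phys. Rev. 83 (1951) 1260, eq. (2) [cite: Anderson1951, eq. (2)]; R. Valentí, J. Stolze,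
P. J. Hirschfeld, Phys. Rev. B 43 (1991) 13743, §II [cite: ValentiStolzeHirschfeld1991, §II]; D. Ruelle, *Statistical Mechanics*
(1969), §3.4 [cite: Ruelle1969, §3.4]; O. Bratteli, A. Kishimoto, D. W. Robinson, CMP 64 (1978) 41, §3
[cite: BratteliKishimotoRobinson1978, §3 (mean energy functional)]; E. Pavarini et al., PRL 87 (2001) 047003, eq. (1)
[cite: PavariniEtAl2001, eq. (1)].
-/

noncomputable section

namespace Literature.MathematicalPhysics.QuantumLattice

open Matrix Finset HubbardWave0 Literature.Probability.LatticeModels ThermodynamicLimit ClusterLowerBound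
open scoped ComplexOrder

namespace InfVolFermionState

/-- **The mean energy split**: for every state `ω` and all `t, t', s, U, a, W`,
`e_{(t,t',s,U)}(ω) = e_{(t,t',2a,U−W)}(ω) + ((s − 2a)·K₃(ω) + W·D(ω))` with the third-neighbour bond density
`K₃(ω) = e_{Φ''(1)}(ω)` and the double-occupancy density `D(ω) = e_{Φ(0,0,1)}(ω)` — linearity of the mean energy in the
couplings. [cite: BratteliKishimotoRobinson1978, §3 (mean energy functional)] -/
theorem meanEnergy_tpp_eq_add_split (ω : InfVolFermionState 2) (t t' s U a W : ℝ) :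
    ω.meanEnergy (hubbardTT'T''FermionInteraction t t' s U) 2 =
      ω.meanEnergy (hubbardTT'T''FermionInteraction t t' (2 * a) (U - W)) 2 +
        ((s - 2 * a) * ω.meanEnergy (axialRange2HoppingFermionInteraction 2 1) 2 +
          W * ω.meanEnergy (hubbardTTPrimeFermionInteraction 0 0 1) 1) := by
  rw [meanEnergy_hubbardTT'T'' t t' s U ω 2, meanEnergy_hubbardTT'T'' t t' (2 * a) (U - W) ω 2,
    ω.meanEnergy_hubbardTTPrime_eq_one t t' U (by norm_num : (1 : ℝ) ≤ 2),
    ω.meanEnergy_hubbardTTPrime_eq_one t t' (U - W) (by norm_num : (1 : ℝ) ≤ 2),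
    ω.meanEnergy_hubbardTTPrime_eq_coords t t' U, ω.meanEnergy_hubbardTTPrime_eq_coords t t' (U - W)]
  ring

/-- **THE WEIGHTED CLUSTER FLOOR FOR OBJECT M WITH A SPLIT `t''`.** Symmetric weights `τ`, repulsions `υ`, potentials
`ν` on the open `2 × 3` box with `wsumV τ + wsumH τ = t`, `2·wsumD₁ τ = t'`, `2·wsumD₂ τ = t'`, `Σ ν = 0`; an axial weight `a`
in the cluster and a repulsion budget for the remainder: `V ≥ 0`, `2·Σ υ + |s − 2a|·V = U`. ONE kernel table
`σ_k ≤ E₀(hubbardOpenBoxTT'T''W 2 3 τ υ ν a, k)` (`k ≤ 12`) with a supporting line `m ≤ σ_k + μk`, and a certified `t' = 0`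
floor `ℓ ≤ e(1, 0, V, ρ)`, give `2m − 12μρ + |s − 2a|·ℓ ≤ e^M(t,t',s,U; ρ)` at every `0 < ρ < 2`: the translates of
the box and its transpose carry `2a` of every third-neighbour amplitude exactly, the remaining `s − 2a` is priced by the
doubling allowance (pure third-neighbour hopping with repulsion `|s−2a|V` is a nearest-neighbour Hubbard model on each
of the four sublattices `2ℤ² + c`). `a = s/2`: the exact law; `a = 0`: the kinematic word of a weighted `t–t'` table.
[cite: Anderson1951, eq. (2)] [cite: ValentiStolzeHirschfeld1991, §II] [cite: Ruelle1969, §3.4] -/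
theorem tiGroundEnergyDensityAt_tpp_ge_of_boxFloorsW_2x3_split {σ : ℕ → ℝ} {τ : Fin 2 ×ₗ Fin 3 → Fin 2 ×ₗ Fin 3 → ℝ}
    {υ ν : Fin 2 ×ₗ Fin 3 → ℝ} {t t' s U a V ℓ : ℝ} (hτ : ∀ x y, τ x y = τ y x) (ht : wsumV τ + wsumH τ = t)
    (hD₁ : 2 * wsumD₁ τ = t') (hD₂ : 2 * wsumD₂ τ = t') (hV : 0 ≤ V) (hU : 2 * ∑ x, υ x + |s - 2 * a| * V = U)
    (hν : ∑ x, ν x = 0) (hF : ∀ k ≤ 12, σ k ≤ groundEnergy (hubbardOpenBoxTT'T''W 2 3 τ υ ν a) k)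
    (μ m : ℝ) (hm : ∀ k ≤ 12, m ≤ σ k + μ * k) {ρ : ℝ} (hℓ : ℓ ≤ energyDensityTT' 1 0 V ρ)
    (hρ0 : 0 < ρ) (hρ2 : ρ < 2) :
    2 * m - 12 * μ * ρ + |s - 2 * a| * ℓ ≤ (hubbardTT'T''FermionInteraction t t' s U).tiGroundEnergyDensityAt 2 ρ := by
  refine (hubbardTT'T''FermionInteraction t t' s U).le_tiGroundEnergyDensityAt 2
    (exists_isTranslationInvariant_density_eq hρ0 hρ2) fun ω hω hρ => ?_
  -- the exact weighted law for the cluster's share `2a` of the third-neighbour amplitude at the repulsion `2·Σ υ`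
  have hlaw := tiGroundEnergyDensityAt_tpp_ge_of_boxFloorsW_2x3 (t'' := 2 * a) (U := 2 * ∑ x, υ x) hτ ht hD₁ hD₂ rfl hν
    (fun k hk => by rw [show 2 * a / 2 = a by ring]; exact hF k hk) μ m hm hρ0 hρ2
  have hle := (hubbardTT'T''FermionInteraction t t' (2 * a) (2 * ∑ x, υ x)).tiGroundEnergyDensityAt_le_meanEnergy 2 hω hρ
  -- the dressed allowance for the remainder `s − 2a`
  have hρ0' : 0 < ω.density := by rw [hρ]; exact hρ0
  have hρ2' : ω.density < 2 := by rw [hρ]; exact hρ2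
  have hbr := hω.abs_mul_energyDensityTT'_nn_le_tpp_add hρ0' hρ2' (s - 2 * a) hV
  rw [hρ] at hbr
  have hℓ' := mul_le_mul_of_nonneg_left hℓ (abs_nonneg (s - 2 * a))
  -- assemble
  have hsplit := ω.meanEnergy_tpp_eq_add_split t t' s U a (|s - 2 * a| * V)
  rw [show U - |s - 2 * a| * V = 2 * ∑ x, υ x by rw [← hU]; ring] at hsplit
  rw [hsplit]
  nlinarith [hlaw, hle, hbr, hℓ']

/-- **`V = 0`, free-band form**: with the cluster repulsion carrying all of `U` (`2·Σ υ = U`) and any certified constant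
`ℓ ≤ e(1, 0, 0, ρ)` below the free nearest-neighbour band energy (e.g. `ℓ = −16/π²`-type kinematic rows), one weighted table
with axial weight `a` gives `2m − 12μρ + |s − 2a|·ℓ ≤ e^M(t,t',s,U; ρ)`. [cite: Ruelle1969, §3.4] -/
theorem tiGroundEnergyDensityAt_tpp_ge_of_boxFloorsW_2x3_split_free {σ : ℕ → ℝ} {τ : Fin 2 ×ₗ Fin 3 → Fin 2 ×ₗ Fin 3 → ℝ}
    {υ ν : Fin 2 ×ₗ Fin 3 → ℝ} {t t' s U a ℓ : ℝ} (hτ : ∀ x y, τ x y = τ y x) (ht : wsumV τ + wsumH τ = t)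
    (hD₁ : 2 * wsumD₁ τ = t') (hD₂ : 2 * wsumD₂ τ = t') (hU : 2 * ∑ x, υ x = U) (hν : ∑ x, ν x = 0)
    (hF : ∀ k ≤ 12, σ k ≤ groundEnergy (hubbardOpenBoxTT'T''W 2 3 τ υ ν a) k)
    (μ m : ℝ) (hm : ∀ k ≤ 12, m ≤ σ k + μ * k) {ρ : ℝ} (hℓ : ℓ ≤ energyDensityTT' 1 0 0 ρ)
    (hρ0 : 0 < ρ) (hρ2 : ρ < 2) :
    2 * m - 12 * μ * ρ + |s - 2 * a| * ℓ ≤ (hubbardTT'T''FermionInteraction t t' s U).tiGroundEnergyDensityAt 2 ρ :=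
  tiGroundEnergyDensityAt_tpp_ge_of_boxFloorsW_2x3_split hτ ht hD₁ hD₂ le_rfl (by rw [mul_zero, add_zero]; exact hU) hν hF μ m
    hm hℓ hρ0 hρ2

end InfVolFermionState

end Literature.MathematicalPhysics.QuantumLattice

end
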